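import Mathlib.GroupTheory.FreeGroup.Reduce
import Mathlib.GroupTheory.Commutator.Basic
import Mathlib.GroupTheory.Abelianization.Defs
import Mathlib.Algebra.FreeAbelianGroup.Finsupp
import Mathlib.Data.Fintype.Fin
import Mathlib.Analysis.SpecialFunctions.Pow.Real
import Mathlib.Analysis.SpecialFunctions.Pow.Asymptotics
import Mathlib.Order.Filter.AtTopBot.Basic
import HarnessLib

/-!
# Random rigidity of stable commutator length in free groups (Calegari–Walker 2013)

D. Calegari and A. Walker, *Random rigidity in the free group*, Geom. Topol. **17** (2013)
1707–1744 [CalegariWalker2013] (arXiv:1104.1768; read pp. 5, 8, 10–11), Theorem 4.1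
(**Random Rigidity Theorem**):

> Let `F` be a free group of rank `k`, and let `v` be a random reduced element of length `n`,
> conditioned to lie in the commutator subgroup `[F,F]`. Then for any `ε > 0` and `C > 1`,
> `|scl(v) log(n)/n − log(2k−1)/6| ≤ ε` with probability `1 − O(n^{−C})`.

It is the conjunction of the upper bound Prop. 4.2 (which even has an exponential tail
`1 − O(C^{−n^c})`, extremal fatgraphs glued from tripods) and the lower bound Prop. 4.9
(`log(2k−1)/6 − scl(v) log(n)/n ≤ ε` with probability `1 − O(n^{−C})` for every `C`, via combs);
"random reduced element of length `n` conditioned to lie in `[F,F]`" is the uniform measure on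
`F_n' = F_n ∩ [F,F]`, `F_n` = the elements of word length `n` (loc. cit. §2.1, §2.3; `F_n'` is
empty for odd `n`, Sharp's theorem, loc. cit. Thm. 2.1), and `cl`, `scl` are those of loc. cit.
Def. 3.1: `cl(g)` = the least number of commutators whose product is `g ∈ [G,G]`,
`scl(g) = lim_n cl(gⁿ)/n`.

## Rendering

* `commutatorLength g := sInf {m | g is a product of m commutators}` (junk value `0` off `[G,G]`)
  and `stableCommutatorLength g := ⨅ k, cl(g^{k+1})/(k+1)`: since `n ↦ cl(gⁿ)` is subadditive,
  `lim cl(gⁿ)/n = inf cl(gⁿ)/n` (Fekete), so this is Def. 3.1; both bodies are LITERALLY the terms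
  inlined by route `Summit.PneNP.PneNP.Theses.BavardGap` (item `GapDivergesInProbability`).
* Elements of `F = FreeGroup (Fin k)` of length `n` ↔ reduced words `w : Fin n → Fin k × Bool`
  (`FreeGroup.reduce (List.ofFn w) = List.ofFn w`, Mathlib's normal form), the finset
  `reducedWords k n`; conditioning on `[F,F]` = the sub-finset `commutatorWords k n` of those with
  `FreeGroup.mk (List.ofFn w) ∈ commutator F`. For a free group this says that all exponent sums
  vanish — the "balanced" rendering used by the route — and that equivalence is PROVED here
  (`mk_ofFn_mem_commutator_iff`, via `[F,F] = ker (F → F^{ab})`, Mathlib `Abelianization.ker_of`,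
  and `F^{ab} ≅ ℤ^{(k)}`, Mathlib `FreeAbelianGroup.equivFinsupp`), whence
  `commutatorWords_eq_filter_balanced`: `commutatorWords k n` IS the route's null finset.
* "with probability `1 − O(n^{−C})`": there is `K` such that for all large `n` the number of
  `w ∈ F_n'` violating the inequality is `≤ K · n^{−C} · #F_n'` (vacuous when `F_n' = ∅`).
* Rank: the theorem is about free groups of rank `k ≥ 2` (for `k = 1`, `[F,F] = 1`); we require
  `2 ≤ k`.

## References

* [CalegariWalker2013] D. Calegari, A. Walker, *Random rigidity in the free group*, Geom. Topol.
  17 (2013) 1707–1744, doi:10.2140/gt.2013.17.1707; arXiv:1104.1768: Def. 3.1, Thm. 4.1,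
  Props. 4.2, 4.9.
* D. Calegari, *scl*, MSJ Memoirs 20 (2009), Def. 2.1 (cl, scl). [Calegari2009]
-/

noncomputable section

open Filter

namespace Literature.GroupTheory.CombinatorialGroupTheory

/-! ### Commutator length and stable commutator length -/

section Scl

variable {G : Type*} [Group G]

/-- **Commutator length** `cl(g)`: the least number `m` such that `g` is a product of `m`
commutators `[a₁,b₁]⋯[a_m,b_m]`, `[a,b] = a b a⁻¹ b⁻¹` (Calegari–Walker Def. 3.1; Calegari, *scl*,
Def. 2.1). Junk value `0` (`Nat.sInf` of the empty set) for `g ∉ [G,G]`. The body is verbatim the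
term inlined by route `BavardGap` (`GapDivergesInProbability`). [cite: CalegariWalker2013, Def. 3.1] -/
def commutatorLength (g : G) : ℕ :=
  sInf {m : ℕ | ∃ l : List (G × G), l.length = m ∧ (l.map fun p => p.1 * p.2 * p.1⁻¹ * p.2⁻¹).prod = g}

/-- Unfolding of `commutatorLength` (`rfl`). [folklore] -/
theorem commutatorLength_def (g : G) :
    commutatorLength g =
      sInf {m : ℕ | ∃ l : List (G × G), l.length = m ∧
        (l.map fun p => p.1 * p.2 * p.1⁻¹ * p.2⁻¹).prod = g} :=
  rfl

/-- The identity has commutator length `0` (empty product). [folklore] -/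
@[simp]
theorem commutatorLength_one : commutatorLength (1 : G) = 0 := by
  apply Nat.eq_zero_of_le_zero
  exact Nat.sInf_le ⟨[], rfl, by simp⟩

/-- A single commutator has commutator length `≤ 1`. [folklore] -/
theorem commutatorLength_commutatorElement_le (a b : G) :
    commutatorLength (a * b * a⁻¹ * b⁻¹) ≤ 1 :=
  Nat.sInf_le ⟨[(a, b)], rfl, by simp⟩

/-- A product of `m` commutators lies in the commutator subgroup. [folklore] -/
theorem prod_map_commutator_mem (l : List (G × G)) :
    (l.map fun p => p.1 * p.2 * p.1⁻¹ * p.2⁻¹).prod ∈ commutator G := by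
  induction l with
  | nil => simp [one_mem]
  | cons p l ih =>
    rw [List.map_cons, List.prod_cons]
    refine mul_mem ?_ ih
    rw [commutator_def]
    simpa [commutatorElement_def] using
      Subgroup.commutator_mem_commutator (Subgroup.mem_top p.1) (Subgroup.mem_top p.2)

/-- An element of the commutator subgroup is a product of finitely many commutators, so the set
in the definition of `commutatorLength` is nonempty exactly on `[G,G]`. [folklore] -/
theorem exists_list_prod_eq_iff_mem_commutator (g : G) :
    (∃ l : List (G × G), (l.map fun p => p.1 * p.2 * p.1⁻¹ * p.2⁻¹).prod = g) ↔
      g ∈ commutator G := by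
  constructor
  · rintro ⟨l, rfl⟩
    exact prod_map_commutator_mem l
  · intro hg
    rw [commutator_def] at hg
    induction hg using Subgroup.closure_induction with
    | mem x hx =>
      obtain ⟨a, -, b, -, rfl⟩ := hx
      exact ⟨[(a, b)], by simp [commutatorElement_def]⟩
    | one => exact ⟨[], by simp⟩
    | mul x y _ _ hx hy =>
      obtain ⟨l₁, rfl⟩ := hx
      obtain ⟨l₂, rfl⟩ := hy
      exact ⟨l₁ ++ l₂, by simp⟩
    | inv x _ hx =>
      obtain ⟨l, rfl⟩ := hx
      refine ⟨(l.map fun p => (p.2, p.1)).reverse, ?_⟩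
      rw [List.map_reverse, List.prod_reverse_noncomm, List.map_map, List.map_map]
      simp [Function.comp_def, mul_assoc]

/-- **Stable commutator length** `scl(g) = lim_n cl(gⁿ)/n` (Calegari–Walker Def. 3.1; Calegari,
*scl*, Def. 2.1), rendered as `⨅ k, cl(g^{k+1})/(k+1)`: `n ↦ cl(gⁿ)` is subadditive
(`cl(g^{m+n}) ≤ cl(g^m) + cl(g^n)`), so the limit exists and equals the infimum (Fekete's lemma).
The body is verbatim the term inlined by route `BavardGap` (`GapDivergesInProbability`).
[cite: CalegariWalker2013, Def. 3.1] -/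
def stableCommutatorLength (g : G) : ℝ :=
  ⨅ k : ℕ, (commutatorLength (g ^ (k + 1)) : ℝ) / ((k : ℝ) + 1)

/-- Unfolding of `stableCommutatorLength` (`rfl`). [folklore] -/
theorem stableCommutatorLength_def (g : G) :
    stableCommutatorLength g = ⨅ k : ℕ, (commutatorLength (g ^ (k + 1)) : ℝ) / ((k : ℝ) + 1) :=
  rfl

/-- `scl(g) ≥ 0`. [folklore] -/
theorem stableCommutatorLength_nonneg (g : G) : 0 ≤ stableCommutatorLength g :=
  Real.iInf_nonneg fun _ => by positivity

/-- `scl(g) ≤ cl(g)` (the term `k = 0` of the infimum). [folklore] -/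
theorem stableCommutatorLength_le_commutatorLength (g : G) :
    stableCommutatorLength g ≤ commutatorLength g := by
  have h := ciInf_le (f := fun k : ℕ => (commutatorLength (g ^ (k + 1)) : ℝ) / ((k : ℝ) + 1))
    ⟨0, Set.forall_mem_range.mpr fun _ => by positivity⟩ 0
  simpa [stableCommutatorLength] using h

end Scl

/-! ### `[F,F]` = balanced words (exponent sums) -/

section Balanced

variable {α : Type*}

/-- The exponent-sum homomorphism `F(α) →* ℤ^{(α)}` (written multiplicatively),
`xₐ ↦ eₐ`. [folklore] -/
def expSum : FreeGroup α →* Multiplicative (α →₀ ℤ) :=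
  FreeGroup.lift fun a => Multiplicative.ofAdd (Finsupp.single a 1)

/-- `expSum` on a generator. [folklore] -/
theorem expSum_of (a : α) :
    expSum (FreeGroup.of a) = Multiplicative.ofAdd (Finsupp.single a 1) := by
  simp [expSum]

/-- `F(α)^{ab} ≅ ℤ^{(α)}` multiplicatively: Mathlib's `FreeAbelianGroup α := Additive F(α)^{ab}` and
`FreeAbelianGroup.equivFinsupp`. [folklore] -/
def abelianizationEquivFinsupp (α : Type*) :
    Abelianization (FreeGroup α) ≃* Multiplicative (α →₀ ℤ) :=
  (MulEquiv.multiplicativeAdditive (Abelianization (FreeGroup α))).symm.trans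
    (AddEquiv.toMultiplicative (FreeAbelianGroup.equivFinsupp α))

/-- The isomorphism `F^{ab} ≅ ℤ^{(α)}` composed with `F → F^{ab}` is the exponent sum. [folklore] -/
theorem abelianizationEquivFinsupp_of (x : FreeGroup α) :
    abelianizationEquivFinsupp α (Abelianization.of x) = expSum x := by
  suffices h : ((abelianizationEquivFinsupp α).toMonoidHom.comp Abelianization.of :
      FreeGroup α →* _) = expSum from
    DFunLike.congr_fun h x
  refine FreeGroup.ext_hom _ _ fun a => ?_
  rw [expSum_of]
  change Multiplicative.ofAdd (FreeAbelianGroup.toFinsupp (FreeAbelianGroup.of a)) = _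
  rw [FreeAbelianGroup.toFinsupp_of]

/-- `x ∈ [F,F]` iff all exponent sums of `x` vanish (`[F,F] = ker (F → F^{ab})`,
Mathlib `Abelianization.ker_of`, and `F^{ab} ≅ ℤ^{(α)}`). [folklore] -/
theorem mem_commutator_iff_expSum_eq_one (x : FreeGroup α) :
    x ∈ commutator (FreeGroup α) ↔ expSum x = 1 := by
  rw [← Abelianization.ker_of, MonoidHom.mem_ker, ← abelianizationEquivFinsupp_of,
    MulEquiv.map_eq_one_iff]

/-- The exponent sum of a word, letter by letter. [folklore] -/
theorem expSum_mk (L : List (α × Bool)) :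
    expSum (FreeGroup.mk L) =
      Multiplicative.ofAdd (L.map fun x => if x.2 then Finsupp.single x.1 (1 : ℤ)
        else -Finsupp.single x.1 1).sum := by
  induction L with
  | nil => simp [expSum]
  | cons x L ih =>
    rw [← List.singleton_append, ← FreeGroup.mul_mk, map_mul, ih, List.map_append,
      List.sum_append, ofAdd_add]
    congr 1
    obtain ⟨a, b⟩ := x
    cases b
    · have : FreeGroup.mk [(a, false)] = (FreeGroup.of a)⁻¹ := by
        rw [FreeGroup.of, FreeGroup.inv_mk]; rfl
      rw [this, map_inv, expSum_of]
      simp [ofAdd_neg]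
    · have : FreeGroup.mk [(a, true)] = FreeGroup.of a := rfl
      rw [this, expSum_of]
      simp

/-- The `a`-th exponent sum of a word is `#(a, +1) − #(a, −1)`. [folklore] -/
theorem sum_map_ite_single_apply [DecidableEq α] (L : List (α × Bool)) (a : α) :
    (L.map fun x => if x.2 then Finsupp.single x.1 (1 : ℤ) else -Finsupp.single x.1 1).sum a =
      (L.count (a, true) : ℤ) - (L.count (a, false) : ℤ) := by
  induction L with
  | nil => simp
  | cons x L ih =>
    rw [List.map_cons, List.sum_cons, Finsupp.add_apply, ih, List.count_cons, List.count_cons]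
    obtain ⟨b, c⟩ := x
    cases c <;> by_cases hb : b = a <;> simp [hb] <;> omega

/-- **`[F,F]` = balanced words**: a word represents an element of the commutator subgroup of the
free group iff for every generator `a` the letters `a` and `a⁻¹` occur equally often. [folklore] -/
theorem mk_mem_commutator_iff_count [DecidableEq α] (L : List (α × Bool)) :
    FreeGroup.mk L ∈ commutator (FreeGroup α) ↔ ∀ a, L.count (a, true) = L.count (a, false) := by
  rw [mem_commutator_iff_expSum_eq_one, expSum_mk]
  constructor
  · intro h a
    have h' := congrArg (fun f : Multiplicative (α →₀ ℤ) => (Multiplicative.toAdd f) a) h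
    simp only [toAdd_ofAdd, toAdd_one, Finsupp.coe_zero, Pi.zero_apply] at h'
    rw [sum_map_ite_single_apply] at h'
    omega
  · intro h
    rw [← ofAdd_zero]
    congr 1
    ext a
    rw [sum_map_ite_single_apply, h a]
    simp

/-- Counting occurrences of a value in `List.ofFn w`. [folklore] -/
theorem count_ofFn {β : Type*} [BEq β] [LawfulBEq β] [DecidableEq β] {n : ℕ} (w : Fin n → β)
    (p : β) : (List.ofFn w).count p = (Finset.univ.filter fun i => w i = p).card := by
  rw [List.ofFn_eq_map, List.count, List.countP_map, List.countP_eq_length_filter]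
  rw [Fin.univ_def, Finset.card_def, Finset.filter_val]
  simp [Function.comp_def, Multiset.filter_coe, beq_eq_decide]

/-- The route's rendering (`BavardGap`): `w : Fin n → Fin k × Bool` represents an element of
`[F,F]` iff its letter counts are balanced. [folklore] -/
theorem mk_ofFn_mem_commutator_iff {k n : ℕ} (w : Fin n → Fin k × Bool) :
    FreeGroup.mk (List.ofFn w) ∈ commutator (FreeGroup (Fin k)) ↔
      ∀ a : Fin k, (Finset.univ.filter fun i => w i = (a, true)).card =
        (Finset.univ.filter fun i => w i = (a, false)).card := by
  rw [mk_mem_commutator_iff_count]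
  refine forall_congr' fun a => ?_
  rw [count_ofFn, count_ofFn]

end Balanced

/-! ### The random model: reduced words of length `n` in `[F,F]` -/

section RandomWords

open scoped Classical

/-- The elements of word length `n` of the free group `F = FreeGroup (Fin k)` of rank `k`, as
reduced words `w : Fin n → Fin k × Bool` (`(i, true) = xᵢ`, `(i, false) = xᵢ⁻¹`; reduced =
fixed by Mathlib's `FreeGroup.reduce`): the set `F_n` of Calegari–Walker §2.1/§2.3, of
cardinality `2k(2k−1)^{n−1}` for `n ≥ 1`. [cite: CalegariWalker2013, §2.1 and §2.3] -/
def reducedWords (k n : ℕ) : Finset (Fin n → Fin k × Bool) :=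
  Finset.univ.filter fun w => FreeGroup.reduce (List.ofFn w) = List.ofFn w

/-- The elements of length `n` lying in the commutator subgroup: `F_n' = F_n ∩ [F,F]`
(Calegari–Walker §2.1; empty for odd `n`, Sharp's theorem = loc. cit. Thm. 2.1). The uniform
measure on this finset is "a random reduced element of length `n` conditioned to lie in `[F,F]`".
[cite: CalegariWalker2013, §2.1] -/
def commutatorWords (k n : ℕ) : Finset (Fin n → Fin k × Bool) :=
  (reducedWords k n).filter fun w =>
    FreeGroup.mk (List.ofFn w) ∈ commutator (FreeGroup (Fin k))

/-- Membership in `reducedWords`, unfolded. [folklore] -/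
theorem mem_reducedWords_iff {k n : ℕ} (w : Fin n → Fin k × Bool) :
    w ∈ reducedWords k n ↔ FreeGroup.reduce (List.ofFn w) = List.ofFn w := by
  simp [reducedWords]

/-- Membership in `commutatorWords`, unfolded. [folklore] -/
theorem mem_commutatorWords_iff {k n : ℕ} (w : Fin n → Fin k × Bool) :
    w ∈ commutatorWords k n ↔ FreeGroup.reduce (List.ofFn w) = List.ofFn w ∧
      FreeGroup.mk (List.ofFn w) ∈ commutator (FreeGroup (Fin k)) := by
  simp [commutatorWords, reducedWords]

/-- `F_n' ⊆ F_n`. [folklore] -/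
theorem commutatorWords_subset (k n : ℕ) : commutatorWords k n ⊆ reducedWords k n :=
  Finset.filter_subset _ _

/-- **`commutatorWords` is the route's null finset**: reduced words of length `n` with balanced
letter counts (route `BavardGap`, `NULL`, there with `k = 2` and length `2n`). [folklore] -/
theorem commutatorWords_eq_filter_balanced (k n : ℕ) :
    commutatorWords k n = Finset.univ.filter fun w : Fin n → Fin k × Bool =>
      FreeGroup.reduce (List.ofFn w) = List.ofFn w ∧
        ∀ a : Fin k, (Finset.univ.filter fun i => w i = (a, true)).card =
          (Finset.univ.filter fun i => w i = (a, false)).card := by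
  ext w
  simp only [mem_commutatorWords_iff, Finset.mem_filter, Finset.mem_univ, true_and,
    mk_ofFn_mem_commutator_iff]

/-! ### The named fact -/

/-- **Calegari–Walker 2013, Theorem 4.1 (Random Rigidity Theorem).** *Let `F` be a free group of
rank `k` (`≥ 2`), and let `v` be a random reduced element of length `n`, conditioned to lie in the
commutator subgroup `[F,F]`. Then for any `ε > 0` and `C > 1`,
`|scl(v) log(n)/n − log(2k−1)/6| ≤ ε` with probability `1 − O(n^{−C})`.* Rendered on the uniform
measure on `commutatorWords k n` (`= F_n ∩ [F,F]` as reduced words `Fin n → Fin k × Bool`): there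
is `K` such that for all sufficiently large `n` the number of `w ∈ F_n'` with
`|scl(w) log(n)/n − log(2k−1)/6| > ε` is at most `K · n^{−C} · #F_n'`; `scl` is
`stableCommutatorLength` (Def. 3.1). Upper bound = Prop. 4.2 (exponential tail), lower bound =
Prop. 4.9. [cite: CalegariWalker2013, Thm. 4.1 (with Props. 4.2, 4.9)] -/
def CalegariWalker2013_randomRigidity : Prop :=
  ∀ k : ℕ, 2 ≤ k → ∀ ε : ℝ, 0 < ε → ∀ C : ℝ, 1 < C → ∃ K : ℝ, ∀ᶠ n : ℕ in atTop,
    ((((commutatorWords k n).filter fun w =>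
        ε < |stableCommutatorLength (FreeGroup.mk (List.ofFn w)) * Real.log n / n -
              Real.log (2 * k - 1) / 6|).card : ℕ) : ℝ) ≤
      K * (n : ℝ) ^ (-C) * ((commutatorWords k n).card : ℝ)

/-- **Corollary (convergence in probability, the form used by route `BavardGap`).** Under
`CalegariWalker2013_randomRigidity`, for `k ≥ 2` and `ε > 0` the proportion of `w ∈ F_n'` with
`|scl(w) log(n)/n − log(2k−1)/6| > ε` tends to `0` (indeed is `O(n^{−2})`; the proportion is read
as `0` when `F_n' = ∅`, e.g. for odd `n`). [cite: CalegariWalker2013, Thm. 4.1] -/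
theorem CalegariWalker2013_randomRigidity.tendsto_zero (h : CalegariWalker2013_randomRigidity)
    {k : ℕ} (hk : 2 ≤ k) {ε : ℝ} (hε : 0 < ε) :
    Tendsto (fun n : ℕ =>
      ((((commutatorWords k n).filter fun w =>
          ε < |stableCommutatorLength (FreeGroup.mk (List.ofFn w)) * Real.log n / n -
                Real.log (2 * k - 1) / 6|).card : ℕ) : ℝ) /
        ((commutatorWords k n).card : ℝ)) atTop (nhds 0) := by
  obtain ⟨K, hK⟩ := h k hk ε hε 2 one_lt_two
  -- squeeze between `0` and `max K 0 * n ^ (-2)`, which tends to `0`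
  have hlim : Tendsto (fun n : ℕ => max K 0 * (n : ℝ) ^ (-(2 : ℝ))) atTop (nhds 0) := by
    have h0 : Tendsto (fun n : ℕ => (n : ℝ) ^ (-(2 : ℝ))) atTop (nhds 0) :=
      (tendsto_rpow_neg_atTop (by norm_num : (0 : ℝ) < 2)).comp tendsto_natCast_atTop_atTop
    simpa using h0.const_mul (max K 0)
  refine tendsto_of_tendsto_of_tendsto_of_le_of_le' tendsto_const_nhds hlim
    (Eventually.of_forall fun n => by positivity) ?_
  filter_upwards [hK] with n hn
  have hn' := hn.trans (mul_le_mul_of_nonneg_right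
    (mul_le_mul_of_nonneg_right (le_max_left K 0) (Real.rpow_nonneg (Nat.cast_nonneg n) _))
    (Nat.cast_nonneg _))
  rcases Nat.eq_zero_or_pos (commutatorWords k n).card with h0 | hpos
  · have hle := Finset.card_filter_le (commutatorWords k n) fun w =>
        ε < |stableCommutatorLength (FreeGroup.mk (List.ofFn w)) * Real.log n / n -
              Real.log (2 * k - 1) / 6|
    have hb : ((commutatorWords k n).filter fun w =>
        ε < |stableCommutatorLength (FreeGroup.mk (List.ofFn w)) * Real.log n / n -
              Real.log (2 * k - 1) / 6|).card = 0 := by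
      omega
    rw [hb, h0]
    simpa using mul_nonneg (le_max_right K 0) (Real.rpow_nonneg (Nat.cast_nonneg n) (-(2 : ℝ)))
  · rw [div_le_iff₀ (by exact_mod_cast hpos)]
    exact hn'

end RandomWords

end Literature.GroupTheory.CombinatorialGroupTheory

end
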